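import Literature.Probability.RandomPlanarGeometry.RestrictionDerivTime
import Literature.Probability.RandomPlanarGeometry.LoewnerImageStep
import HarnessLib

/-!
# All of `A` survives a short step with small driver oscillation ([LSW] §5, `t < T`)

Deterministic survival lemma behind the conditional one-step argument for the restriction
martingale: if the hulls have not reached the `*`-hull `A` at time `u`, the slid hull `A_u - W_u`
misses `B(0, 8ρ₀)`, and on `[u, u + h]` the driver oscillates by at most `S` with
`S + 4√h ≤ ρ₀` and `h ≤ (ρ₀/4)²`, then EVERY point of `A` — real points included — is still alive
at time `u + h` (`forall_coe_add_lt_swallowingTime`). For points of `ℍ` this is Lawler's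
Lemma 4.13 for the shifted flow (`alive_of_stepSize_le`) and the cocycle
(`coe_add_lt_swallowingTime`); a real point of `A` cannot be swallowed in `(u, u + h]` either,
because the flows of the nearby points of `A ∩ ℍ` stay `4ρ₀` away from the driver (forward
barrier `norm_map_sub_ge_of_after`), hence so does its own flow (continuity of `g_r` at an
alive point), contradicting the extension criterion. Consequences: the hulls have not reached `A`
at `u + h` (`disjoint_closedHull_add`) and the slid hull at `u + h` is the one-step image of the
slid hull at `u` under the shifted driver (`slidHull_add`).

## References

* G. F. Lawler, *Conformally Invariant Processes in the Plane* (2005), Lemma 4.13, Rem. 4.9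
  [Lawler2005].
* G. F. Lawler, O. Schramm, W. Werner, *Conformal restriction: the chordal case* (2003), §5
  [LawlerSchrammWerner2003Restriction].
-/

noncomputable section

open Set Filter Metric Function
open _root_.Complex _root_.Topology
open UpperHalfPlane (upperHalfPlaneSet)
open scoped NNReal

namespace Literature.Probability.RandomPlanarGeometry

namespace Loewner

variable {W : ℝ≥0 → ℝ} {A : Set ℂ} {z : ℂ}

/-! ### The extension criterion, in the form "a swallowed point comes close to the driver" -/

/-- If `z` is swallowed at the finite time `τ`, then after any alive time `s < τ` its flow comes
`ε`-close to the driver before `τ`. [cite: Lawler2005, Ch. 4 §4.1] -/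
theorem exists_norm_map_sub_lt_of_swallowingTime_eq (hW : Continuous W) {τ s : ℝ≥0}
    (hτ : swallowingTime W z = τ) (hs : s < τ) {ε : ℝ} (hε : 0 < ε) :
    ∃ r : ℝ≥0, s ≤ r ∧ r < τ ∧ ‖map W r z - W r‖ < ε := by
  have hsT : (s : WithTop ℝ≥0) < swallowingTime W z := by rw [hτ]; exact_mod_cast hs
  have hz : z ≠ W 0 := ne_driving_of_lt_swallowingTime hsT
  have hτpos : 0 < τ := lt_of_le_of_lt bot_le hs
  obtain ⟨G, hG⟩ := exists_isSolution_swallowingTime_holds hW hz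
  -- away from the driver on `[0, s]`
  obtain ⟨δ, hδ, hfar⟩ := hG.exists_le_norm_sub hW s.coe_nonneg (by simpa using hsT)
  rw [hτ] at hG
  by_contra hcon
  push Not at hcon
  have hδ' : (0 : ℝ) < min (δ : ℝ) ε := lt_min (by exact_mod_cast hδ) hε
  have key := hG.coe_lt_swallowingTime_of_le_norm_sub hW hτpos (δ := ⟨min (δ : ℝ) ε, hδ'.le⟩) hδ' fun t ht0 htτ ↦ ?_
  · rw [hτ] at key; exact lt_irrefl _ key
  · show min (δ : ℝ) ε ≤ ‖G t - W t.toNNReal‖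
    rcases le_or_gt t s with hts | hts
    · exact (min_le_left _ _).trans (hfar t ⟨ht0, hts⟩)
    · have htτ' : t.toNNReal < τ := by
        rw [← NNReal.coe_lt_coe, Real.coe_toNNReal t ht0]; exact htτ
      have hst : s ≤ t.toNNReal := by
        rw [← NNReal.coe_le_coe, Real.coe_toNNReal t ht0]; exact hts.le
      have h1 := hcon t.toNNReal hst htτ'
      have hmap : map W t.toNNReal z = G t := by
        rw [map_eq_of_isSolution hW hG (by exact_mod_cast htτ'), Real.coe_toNNReal t ht0]
      rw [hmap] at h1
      exact (min_le_right _ _).trans h1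

/-! ### Survival of all points of `A` -/

section Survival

variable (hW : Continuous W) (hA : IsStarHull A) {u h : ℝ≥0} {ρ₀ S : ℝ}
  (hu : Disjoint (closedHull W u) A) (hρ₀ : 0 < ρ₀) (hBρ : Disjoint (ball (0 : ℂ) (8 * ρ₀)) (slidHull W A u))
  (hh : 0 < h) (hS : ∀ r : ℝ≥0, r ≤ h → |W (u + r) - W u| ≤ S) (hη : stepSize S h ≤ ρ₀)
  (hh4 : (h : ℝ) ≤ (ρ₀ / 4) ^ 2)

include hBρ in
/-- Points of the slid hull are `≥ 8ρ₀` away from `0`. [folklore] -/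
theorem norm_ge_of_mem_slidHull {b : ℂ} (hb : b ∈ slidHull W A u) : 8 * ρ₀ ≤ ‖b‖ := by
  by_contra hlt
  exact Set.disjoint_left.1 hBρ (mem_ball_zero_iff.2 (not_le.1 hlt)) hb

include hW hA hu hBρ hh hS hη in
/-- **Points of `A ∩ ℍ` survive the step** (Lawler's Lemma 4.13 for the shifted flow, and the cocycle).
[cite: Lawler2005, Lemma 4.13 and Rem. 4.9] -/
theorem coe_add_lt_swallowingTime_of_im_pos {a : ℂ} (ha : a ∈ A) (haim : 0 < a.im) :
    ((u + h : ℝ≥0) : WithTop ℝ≥0) < swallowingTime W a := by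
  have haT : (u : WithTop ℝ≥0) < swallowingTime W a := lt_swallowingTime_of_alive hA hu ha
  have hdom : a ∈ domain W u := (mem_domain_iff _ _ _).2 ⟨haim, haT⟩
  set b : ℂ := map W u a - W u with hb
  have hbB : b ∈ slidHull W A u := mem_slidHull_iff.2 ⟨a, ha, rfl⟩
  have hb8 := norm_ge_of_mem_slidHull hBρ hbB
  have hS0 : 0 ≤ S := (abs_nonneg _).trans (hS 0 bot_le)
  have hη' : stepSize S h ≤ ‖b‖ := by
    have h1 : S ≤ stepSize S h := by rw [stepSize]; have := Real.sqrt_nonneg (h : ℝ); linarith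
    have : stepSize S h ≤ 8 * ρ₀ := by linarith [hS0.trans h1]
    exact this.trans hb8
  have hU : Continuous fun r : ℝ≥0 ↦ W (u + r) - W u := (continuous_shift W hW u).sub continuous_const
  obtain ⟨halive, -⟩ := alive_of_stepSize_le hU hh hS hη'
  -- translate: `T^{W(u+·) - W_u}(b) = T^{W(u+·)}(g_u a)`
  have htr : swallowingTime (fun r : ℝ≥0 ↦ W (u + r) - W u) b = swallowingTime (fun r : ℝ≥0 ↦ W (u + r)) (map W u a) := by
    have := swallowingTime_add_const (fun r : ℝ≥0 ↦ W (u + r) - W u) b (W u)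
    simp only [sub_add_cancel] at this
    rw [← this, hb]
    congr 1; ring
  rw [htr] at halive
  exact coe_add_lt_swallowingTime hW hdom halive

include hW hA hu hρ₀ hBρ hh hS hη hh4 in
/-- **The flows of the points of `A ∩ ℍ` stay `4ρ₀` away from the driver on `[u, u + h]`** (forward
barrier). [cite: Lawler2005, Lemma 4.13] -/
theorem norm_map_sub_gt_of_im_pos {a : ℂ} (ha : a ∈ A) (haim : 0 < a.im) {r : ℝ≥0} (hur : u ≤ r) (hr : r ≤ u + h) :
    4 * ρ₀ < ‖map W r a - W r‖ := by
  have hv : ((u + h : ℝ≥0) : WithTop ℝ≥0) < swallowingTime W a := coe_add_lt_swallowingTime_of_im_pos hW hA hu hBρ hh hS hη ha haim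
  have hbB : map W u a - W u ∈ slidHull W A u := mem_slidHull_iff.2 ⟨a, ha, rfl⟩
  have hb8 := norm_ge_of_mem_slidHull hBρ hbB
  have hS0 : 0 ≤ S := (abs_nonneg _).trans (hS 0 bot_le)
  have hSρ : S ≤ ρ₀ := by
    have : (0 : ℝ) ≤ 4 * Real.sqrt h := by positivity
    rw [stepSize] at hη; linarith
  have hΩ : ∀ r' : ℝ≥0, u ≤ r' → r' ≤ u + h → |W r' - W u| ≤ S := fun r' h1 h2 ↦ by
    have := hS (r' - u) (by rw [tsub_le_iff_right, add_comm]; exact h2)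
    rwa [add_tsub_cancel_of_le h1] at this
  have hsmall : 4 * (((u + h : ℝ≥0) : ℝ) - u) / (8 * ρ₀) + S < 8 * ρ₀ / 2 := by
    push_cast
    have h1 : 4 * ((u : ℝ) + h - u) / (8 * ρ₀) = h / (2 * ρ₀) := by field_simp; ring
    rw [h1]
    have h2 : (h : ℝ) / (2 * ρ₀) ≤ ρ₀ / 32 := by
      rw [div_le_iff₀ (by positivity)]; nlinarith
    linarith
  have := (norm_map_sub_ge_of_after hW (le_self_add) hv (by positivity) hb8 hΩ hsmall hur hr).1
  linarith

include hW hA hu hρ₀ hBρ hh hS hη hh4 in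
/-- **Every point of `A` survives the step** — real points too: their flows stay `4ρ₀` away from
the driver on `[u, u + h]` by continuity of `g_r` at an alive point and density of `A ∩ ℍ` in `A`,
so the extension criterion forbids swallowing in `(u, u + h]`.
[cite: LawlerSchrammWerner2003Restriction, §5 (t < T)] -/
theorem forall_coe_add_lt_swallowingTime : ∀ a ∈ A, ((u + h : ℝ≥0) : WithTop ℝ≥0) < swallowingTime W a := by
  intro a ha
  have haT : (u : WithTop ℝ≥0) < swallowingTime W a := lt_swallowingTime_of_alive hA hu ha
  have haim : 0 ≤ a.im := by
    have := hA.isBoundedHull.subset_closure ha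
    rwa [closure_setOf_lt_im] at this
  rcases haim.eq_or_lt with him | him
  swap
  · exact coe_add_lt_swallowingTime_of_im_pos hW hA hu hBρ hh hS hη ha him
  -- `a` real: suppose it is swallowed at `τ ≤ u + h`
  by_contra hle
  rw [not_lt] at hle
  obtain ⟨τ, hτ⟩ := WithTop.ne_top_iff_exists.1 (ne_top_of_le_ne_top WithTop.coe_ne_top hle)
  have hτ' : swallowingTime W a = τ := hτ.symm
  have huτ : u < τ := by
    have : (u : WithTop ℝ≥0) < τ := by rw [hτ]; exact haT
    exact_mod_cast this
  have hτuh : τ ≤ u + h := by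
    have : (τ : WithTop ℝ≥0) ≤ (u + h : ℝ≥0) := by rw [hτ]; exact hle
    exact_mod_cast this
  -- the flow of `a` stays `4ρ₀` away on `[u, τ)`
  have hfar : ∀ r : ℝ≥0, u ≤ r → r < τ → 4 * ρ₀ ≤ ‖map W r a - W r‖ := by
    intro r hur hrτ
    have hrT : (r : WithTop ℝ≥0) < swallowingTime W a := by rw [hτ']; exact_mod_cast hrτ
    have hcont : ContinuousAt (fun w ↦ ‖map W r w - W r‖) a := ((continuousAt_map hW hrT).sub continuousAt_const).norm
    have hcl : a ∈ closure (A ∩ upperHalfPlaneSet) := by rw [hA.isBoundedHull.2.1]; exact ha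
    obtain ⟨w, hw, hwa⟩ := mem_closure_iff_seq_limit.1 hcl
    have hlim : Tendsto (fun k ↦ ‖map W r (w k) - W r‖) atTop (𝓝 ‖map W r a - W r‖) := hcont.tendsto.comp hwa
    refine ge_of_tendsto' hlim fun k ↦ ?_
    exact (norm_map_sub_gt_of_im_pos hW hA hu hρ₀ hBρ hh hS hη hh4 (hw k).1 (hw k).2 hur (hrτ.le.trans hτuh)).le
  -- but the extension criterion brings it `4ρ₀`-close before `τ`
  obtain ⟨r, hur, hrτ, hclose⟩ := exists_norm_map_sub_lt_of_swallowingTime_eq hW hτ' huτ (by positivity : (0 : ℝ) < 4 * ρ₀)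
  exact absurd hclose (not_lt.2 (hfar r hur hrτ))

include hW hA hu hρ₀ hBρ hh hS hη hh4 in
/-- **The hulls have not reached `A` at time `u + h`.** [folklore] -/
theorem disjoint_closedHull_add : Disjoint (closedHull W (u + h)) A := by
  rw [Set.disjoint_left]
  rintro z ⟨-, hzT⟩ hzA
  exact absurd (forall_coe_add_lt_swallowingTime hW hA hu hρ₀ hBρ hh hS hη hh4 z hzA) (not_lt.2 hzT)

include hW hA hu hρ₀ hBρ hh hS hη hh4 in
/-- **The slid hull at `u + h` is the one-step image of the slid hull at `u`** under the shifted
driver `r ↦ W (u + r) - W u`. [cite: Lawler2005, Rem. 4.9] -/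
theorem slidHull_add_eq : slidHull W A (u + h) = slidHull (fun r ↦ W (u + r) - W u) (slidHull W A u) h :=
  slidHull_add hW (forall_coe_add_lt_swallowingTime hW hA hu hρ₀ hBρ hh hS hη hh4)

end Survival

end Loewner

end Literature.Probability.RandomPlanarGeometry
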